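import Mathlib
import HarnessLib
import Summits.QuantumFields.YangMills.Theorems.LangevinControlUVFemtoCurvatureTwoPointOffAxisCore

/-!
# Crux `FemtoCurvatureTwoPoint` (stmt-QuantumFields-9363, route `LangevinControlUV`):
# off-axis domination, part C — the line's stub OA `stub_offAxisDomination` (RP helper part 8)

Helper for the line `generic-step-gamma-encoding` (lead prover, `--supports stmt-QuantumFields-9363`):
PROVES the registered skeleton stub `stub_offAxisDomination` (signature verbatim): for every compact `G`,
continuous `ρ`, torus `(ℤ/L)⁴`, `β ≥ 0`, direction `μ` and plaquette fields `P_x^{ij} = N − Re tr ρ(U_p)`,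
`P_y^{i'j'}` with `m = |(y−x)_μ| ≥ 1`:
`Cov(P_x^{ij}, P_y^{i'j'})² ≤ (Σ_{s<3} |D^{ij}_μ(m−1+s)|) · (Σ_{s<3} |D^{i'j'}_μ(m−1+s)|)`,
`D^{ij}_μ(s) = Cov(P_0^{ij}, P_{s e_μ}^{ij})`. Transport of the time-axis core of part B (`…OffAxisCore`)
by the coordinate permutation `swap 0 μ` (tree `wilsonExpectation_comp_configPerm`), the orientation
blindness of the real trace (`plaquetteHolonomy_swap`, `re_trace_map_inv`) and
`Cov(N − A, N − B) = Cov(A, B)`. With the lead's proved glue `pairUpper_of'` this reduces the crux's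
all-pairs fixed-torus upper clause K2⁺ to the diagonal families (stub DU).
-/

noncomputable section

open MeasureTheory
open Literature.MathematicalPhysics.QuantumFieldTheory

namespace Summit.QuantumFields.YangMills.Theorems.FemtoCurvatureTwoPoint.AxisCovNonneg

section Engines

variable {d L N : ℕ} [NeZero d] [NeZero L] {G : Type*} [Group G] [TopologicalSpace G]
  [IsTopologicalGroup G] [CompactSpace G] [MeasurableSpace G] [BorelSpace G]
  (ρ : G →* Matrix (Fin N) (Fin N) ℂ)

/-- **The time-axis core of off-axis domination**, signed time separation `y₀ − x₀ ≡ ±m`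
(the negative case is the positive one for the swapped pair). [folklore] -/
theorem offAxis_core (hρ : Continuous ρ) {β : ℝ} (hβ : 0 ≤ β)
    (q q' : {p : Fin d × Fin d // p.1 < p.2}) (x y : Site d L) {m : ℕ} (hm1 : 1 ≤ m)
    (hmL : 2 * m ≤ L) (hΔ : y 0 - x 0 = ((m : ℕ) : ZMod L) ∨ y 0 - x 0 = -((m : ℕ) : ZMod L)) :
    (wilsonExpectation ρ β (fun U => WilsonRP.plaqRe ρ U (((x, q) : Plaquette d L)) * WilsonRP.plaqRe ρ U (((y, q') : Plaquette d L)))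
        - wilsonExpectation ρ β (fun U => WilsonRP.plaqRe ρ U (((x, q) : Plaquette d L)))
        * wilsonExpectation ρ β (fun U => WilsonRP.plaqRe ρ U (((y, q') : Plaquette d L)))) ^ 2 ≤
      (∑ s ∈ Finset.range 3, |(wilsonExpectation ρ β (fun U => WilsonRP.plaqRe ρ U ((((0 : Site d L), q) : Plaquette d L)) * WilsonRP.plaqRe ρ U (((Pi.single (0 : Fin d) (((m - 1 + s : ℕ) : ℕ) : ZMod L), q) : Plaquette d L)))
          - wilsonExpectation ρ β (fun U => WilsonRP.plaqRe ρ U ((((0 : Site d L), q) : Plaquette d L)))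
          * wilsonExpectation ρ β (fun U => WilsonRP.plaqRe ρ U (((Pi.single (0 : Fin d) (((m - 1 + s : ℕ) : ℕ) : ZMod L), q) : Plaquette d L))))|) *
      (∑ s ∈ Finset.range 3, |(wilsonExpectation ρ β (fun U => WilsonRP.plaqRe ρ U ((((0 : Site d L), q') : Plaquette d L)) * WilsonRP.plaqRe ρ U (((Pi.single (0 : Fin d) (((m - 1 + s : ℕ) : ℕ) : ZMod L), q') : Plaquette d L)))
          - wilsonExpectation ρ β (fun U => WilsonRP.plaqRe ρ U ((((0 : Site d L), q') : Plaquette d L)))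
          * wilsonExpectation ρ β (fun U => WilsonRP.plaqRe ρ U (((Pi.single (0 : Fin d) (((m - 1 + s : ℕ) : ℕ) : ZMod L), q') : Plaquette d L))))|) := by
  rcases hΔ with hΔ | hΔ
  · exact offAxis_core_pos ρ hρ hβ q q' x y hm1 hmL hΔ
  · have hΔ' : x 0 - y 0 = ((m : ℕ) : ZMod L) := by rw [← neg_sub, hΔ, neg_neg]
    have h := offAxis_core_pos ρ hρ hβ q' q y x hm1 hmL hΔ'
    rw [covPair_symm ρ β ((y, q') : Plaquette d L) ((x, q) : Plaquette d L)] at h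
    exact h.trans (le_of_eq (mul_comm _ _))

/-! ### Transport to the crux's vocabulary: orientation, `Cov(N − A, N − B)`, coordinate permutations -/

omit [NeZero d] [NeZero L] [MeasurableSpace G] [BorelSpace G] in
/-- Every ordered plane is an oriented plaquette plane up to the sign of the holonomy, which the
real trace does not see. [folklore] -/
theorem orient_exists (hρ : Continuous ρ) {i j : Fin d} (hij : i ≠ j) :
    ∃ q : {p : Fin d × Fin d // p.1 < p.2}, ∀ (U : GaugeConfig d L G) (z : Site d L),
      (ρ (plaquetteHolonomy U z i j)).trace.re = WilsonRP.plaqRe ρ U (z, q) := by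
  rcases lt_or_gt_of_ne hij with h | h
  · exact ⟨⟨(i, j), h⟩, fun U z => rfl⟩
  · refine ⟨⟨(j, i), h⟩, fun U z => ?_⟩
    show (ρ (plaquetteHolonomy U z i j)).trace.re = (ρ (plaquetteHolonomy U z j i)).trace.re
    rw [plaquetteHolonomy_swap U z j i,
      Literature.RepresentationTheory.CompactGroups.CompactGroup.re_trace_map_inv ρ hρ]

omit [NeZero d] [NeZero L] [BorelSpace G] in
/-- A coordinate permutation carries oriented plaquette functions to oriented plaquette functions
(up to orientation). [folklore] -/
theorem perm_plane_exists (hρ : Continuous ρ) (π : Equiv.Perm (Fin d))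
    (q : {p : Fin d × Fin d // p.1 < p.2}) :
    ∃ q' : {p : Fin d × Fin d // p.1 < p.2}, ∀ (U : GaugeConfig d L G) (z : Site d L),
      WilsonRP.plaqRe ρ (configPerm π U) (z, q) = WilsonRP.plaqRe ρ U (sitePerm π.symm z, q') := by
  have hne : π.symm q.1.1 ≠ π.symm q.1.2 := fun h => (ne_of_lt q.2) (π.symm.injective h)
  obtain ⟨q', hq'⟩ := orient_exists ρ hρ (L := L) hne
  refine ⟨q', fun U z => ?_⟩
  rw [← hq' U (sitePerm π.symm z)]
  simp only [WilsonRP.plaqRe, plaquetteHolonomy_configPerm]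

omit [NeZero d] in
/-- `Cov(N − P_p, N − P_{p'}) = Cov(P_p, P_{p'})` for plaquette functions. [folklore] -/
theorem cov_constSub_plaqRe (hρ : Continuous ρ) (β : ℝ) (c : ℝ) (p p' : Plaquette d L) :
    wilsonExpectation ρ β (fun U : GaugeConfig d L G =>
        (c - WilsonRP.plaqRe ρ U p) * (c - WilsonRP.plaqRe ρ U p'))
      - wilsonExpectation ρ β (fun U : GaugeConfig d L G => c - WilsonRP.plaqRe ρ U p)
        * wilsonExpectation ρ β (fun U : GaugeConfig d L G => c - WilsonRP.plaqRe ρ U p') =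
    (wilsonExpectation ρ β (fun U => WilsonRP.plaqRe ρ U p * WilsonRP.plaqRe ρ U p') - wilsonExpectation ρ β (fun U => WilsonRP.plaqRe ρ U p)
        * wilsonExpectation ρ β (fun U => WilsonRP.plaqRe ρ U p')) := by
  haveI := isProbabilityMeasure_wilsonMeasure (d := d) (L := L) ρ hρ β
  exact cov_const_sub (wilsonMeasure (d := d) (L := L) ρ β) (WilsonRP.measurable_plaqRe ρ hρ p)
    (WilsonRP.measurable_plaqRe ρ hρ p') ⟨N, fun U => WilsonRP.abs_plaqRe_le ρ hρ U p⟩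
    ⟨N, fun U => WilsonRP.abs_plaqRe_le ρ hρ U p'⟩ c

omit [NeZero d] in
/-- Pair covariances are invariant under coordinate permutations of the torus. [folklore] -/
theorem covPair_perm (hρ : Continuous ρ) (β : ℝ) (π : Equiv.Perm (Fin d)) (a b : Site d L)
    {q q' q₁ q₁' : {p : Fin d × Fin d // p.1 < p.2}}
    (hq : ∀ (U : GaugeConfig d L G) (z : Site d L),
      WilsonRP.plaqRe ρ (configPerm π U) (z, q) = WilsonRP.plaqRe ρ U (sitePerm π.symm z, q₁))
    (hq' : ∀ (U : GaugeConfig d L G) (z : Site d L),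
      WilsonRP.plaqRe ρ (configPerm π U) (z, q') = WilsonRP.plaqRe ρ U (sitePerm π.symm z, q₁')) :
    (wilsonExpectation ρ β (fun U => WilsonRP.plaqRe ρ U (((a, q) : Plaquette d L)) * WilsonRP.plaqRe ρ U (((b, q') : Plaquette d L)))
        - wilsonExpectation ρ β (fun U => WilsonRP.plaqRe ρ U (((a, q) : Plaquette d L)))
        * wilsonExpectation ρ β (fun U => WilsonRP.plaqRe ρ U (((b, q') : Plaquette d L)))) =
      (wilsonExpectation ρ β (fun U => WilsonRP.plaqRe ρ U (((sitePerm π.symm a, q₁) : Plaquette d L)) * WilsonRP.plaqRe ρ U (((sitePerm π.symm b, q₁') : Plaquette d L)))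
          - wilsonExpectation ρ β (fun U => WilsonRP.plaqRe ρ U (((sitePerm π.symm a, q₁) : Plaquette d L)))
          * wilsonExpectation ρ β (fun U => WilsonRP.plaqRe ρ U (((sitePerm π.symm b, q₁') : Plaquette d L)))) := by
  have h1 := wilsonExpectation_comp_configPerm ρ hρ β π
    (fun U : GaugeConfig d L G => WilsonRP.plaqRe ρ U (a, q) * WilsonRP.plaqRe ρ U (b, q'))
  have h2 := wilsonExpectation_comp_configPerm ρ hρ β π
    (fun U : GaugeConfig d L G => WilsonRP.plaqRe ρ U (a, q))
  have h3 := wilsonExpectation_comp_configPerm ρ hρ β π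
    (fun U : GaugeConfig d L G => WilsonRP.plaqRe ρ U (b, q'))
  simp only [Function.comp_def, hq, hq'] at h1 h2 h3
  rw [← h1, ← h2, ← h3]
end Engines

end Summit.QuantumFields.YangMills.Theorems.FemtoCurvatureTwoPoint.AxisCovNonneg

/-! ## Off-axis domination in the crux's vocabulary (registered stub `stub_offAxisDomination`) -/

namespace Summit.QuantumFields.YangMills.Theorems.FemtoCurvatureTwoPoint

open AxisCovNonneg in
/-- **Registered stub `stub_offAxisDomination` (OA) of line `generic-step-gamma-encoding`** (crux
`FemtoCurvatureTwoPoint`, signature verbatim): off-axis domination of every plaquette pair by the two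
diagonal families along any separating direction, window `{m−1, m, m+1}`, for every compact `G`,
continuous `ρ`, torus `(ℤ/L)⁴` and `β ≥ 0`. Transport of `AxisCovNonneg.offAxis_core` (time axis) by the
coordinate permutation `swap 0 μ`, the orientation-blindness of the real trace and
`Cov(N − A, N − B) = Cov(A, B)`. [folklore] -/
theorem stub_offAxisDomination :
    ∀ (G : Type) [Group G] [TopologicalSpace G] [IsTopologicalGroup G] [CompactSpace G]
        [MeasurableSpace G] [BorelSpace G] (N : ℕ) (ρ : G →* Matrix (Fin N) (Fin N) ℂ), Continuous ρ →
      ∀ (L : ℕ) [NeZero L] (β : ℝ), 0 ≤ β →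
        ∀ (P : (Fin 4 → ZMod L) → Fin 4 → Fin 4 → GaugeConfig 4 L G → ℝ)
          (E : (GaugeConfig 4 L G → ℝ) → ℝ),
          (P = fun x i j U => (N : ℝ) - (ρ (plaquetteHolonomy U x i j)).trace.re) →
          (E = fun F => wilsonExpectation ρ β F) →
        ∀ (μ : Fin 4) (x y : Fin 4 → ZMod L) (i j i' j' : Fin 4), i ≠ j → i' ≠ j' →
          1 ≤ ((y μ - x μ).valMinAbs).natAbs →
          (E (fun U => P x i j U * P y i' j' U) - E (P x i j) * E (P y i' j')) ^ 2 ≤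
            (∑ s ∈ Finset.range 3,
                |E (fun U => P 0 i j U *
                    P (Pi.single μ ((((y μ - x μ).valMinAbs).natAbs - 1 + s : ℕ) : ZMod L)) i j U)
                  - E (P 0 i j) *
                    E (P (Pi.single μ ((((y μ - x μ).valMinAbs).natAbs - 1 + s : ℕ) : ZMod L)) i j)|) *
            (∑ s ∈ Finset.range 3,
                |E (fun U => P 0 i' j' U *
                    P (Pi.single μ ((((y μ - x μ).valMinAbs).natAbs - 1 + s : ℕ) : ZMod L)) i' j' U)
                  - E (P 0 i' j') *
                    E (P (Pi.single μ ((((y μ - x μ).valMinAbs).natAbs - 1 + s : ℕ) : ZMod L)) i' j')|) := by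
  intro G _ _ _ _ _ _ N ρ hρ L _ β hβ P E hP hE μ x y i j i' j' hij hij' hm
  subst hP hE
  -- oriented planes for the two ordered index pairs
  obtain ⟨q₁, hq₁⟩ := orient_exists ρ hρ (L := L) hij
  obtain ⟨q₂, hq₂⟩ := orient_exists ρ hρ (L := L) hij'
  simp only [hq₁, hq₂, cov_constSub_plaqRe ρ hρ β]
  -- transport the direction `μ` to the time axis
  set π : Equiv.Perm (Fin 4) := Equiv.swap (0 : Fin 4) μ with hπ
  have hπs : π.symm = π := by simp [hπ]
  have hπμ : π μ = 0 := by simp [hπ]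
  have hπ0 : π 0 = μ := by simp [hπ]
  obtain ⟨r₁, hr₁⟩ := perm_plane_exists ρ hρ (L := L) π q₁
  obtain ⟨r₂, hr₂⟩ := perm_plane_exists ρ hρ (L := L) π q₂
  have hs0 : sitePerm π.symm (0 : Site 4 L) = 0 := by
    funext k; simp only [sitePerm_apply, Pi.zero_apply]
  have hsμ : ∀ c : ZMod L, sitePerm π.symm (Pi.single μ c : Site 4 L) = Pi.single (0 : Fin 4) c := by
    intro c
    rw [sitePerm_single, hπs, hπμ]
  rw [covPair_perm ρ hρ β π x y hr₁ hr₂]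
  simp only [covPair_perm ρ hρ β π 0 _ hr₁ hr₁, covPair_perm ρ hρ β π 0 _ hr₂ hr₂, hs0, hsμ]
  -- the time-axis core
  set m : ℕ := ((y μ - x μ).valMinAbs).natAbs with hmdef
  have hmL : 2 * m ≤ L := by
    have h := ZMod.natAbs_valMinAbs_le (y μ - x μ)
    omega
  have hΔ : (sitePerm π.symm y) 0 - (sitePerm π.symm x) 0 = ((m : ℕ) : ZMod L) ∨
      (sitePerm π.symm y) 0 - (sitePerm π.symm x) 0 = -((m : ℕ) : ZMod L) := by
    simp only [sitePerm_apply, Equiv.symm_symm, hπ0]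
    have hc : (((y μ - x μ).valMinAbs : ℤ) : ZMod L) = y μ - x μ := ZMod.coe_valMinAbs _
    rcases Int.natAbs_eq ((y μ - x μ).valMinAbs) with h | h
    · left
      rw [← hc, h]
      simp [hmdef]
    · right
      rw [← hc, h]
      simp [hmdef]
  exact offAxis_core (L := L) (d := 4) ρ hρ hβ r₁ r₂ (sitePerm π.symm x) (sitePerm π.symm y) hm hmL hΔ

end Summit.QuantumFields.YangMills.Theorems.FemtoCurvatureTwoPoint

end
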